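import Summits.QuantumFields.QCD.Theses.CentreStabilisedCircle

/-!
# The `ℤ₃` colour-flavour-centre (CFC) twist of the centre-stabilised, flavour-twisted slab
# functional, I: the seam twist on the gauge field and on the twisted Wilson–Dirac matrix

Helper file for item stmt-QuantumFields-10528 (`CFCCentreStability`, route
`CentreStabilisedCircle`, sub-problem `QCD` of `QuantumFields`), whose informal statement asserts
that on the mass-degenerate `N_f = 3` line with flavour-twisted temporal boundary phases
`θ_f = θ̄ + 2πf/3` "the `ℤ₃` colour-flavour-centre symmetry is EXACT and `⟨tr P⟩ = 0` in every
finite volume".  The symmetry (Kouno et al. 2012, `ℤ_{N_c}`-symmetric QCD; Roberge–Weiss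
periodicity) is the composite of

* the **seam twist** `U ↦ c·U` multiplying every temporal link leaving the last slice
  `t = N_t − 1` of the circle by the centre element `ω = ζ·1 ∈ SU(3)`, `ζ = e^{2πi/3}`, and
* the **cyclic flavour shift** `f ↦ f + 1`.

This file proves the deterministic (configuration-wise) half, for the objects of
`QCDSlabFunctional.lean`:

* `zeta_smul_one_mem`, `centre_mul_comm` — `ζ·1 ∈ SU(3)` and it is central;
* `weight_seam_mul` — the Wilson weight `SlabGauge.weight ρ β β` is invariant (`ω` is central and
  enters each temporal plaquette once with each sign);
* `polyakovLine_seam_mul`, `polyakovTrace_seam_mul` — every Polyakov loop acquires the factor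
  `ω`, its trace the factor `ζ` (`timeHolonomy_seam_mul`: a holonomy of `n ≤ N_t` steps picks up
  `ω` exactly when it crosses the seam);
* `polyakovDeformationWeight_seam_mul` — the double-trace deformation weight is invariant;
* `qcdCircleDirac_seam_mul` — the twisted Wilson–Dirac matrix at `c·U` is the one at `U` with
  every twist shifted by `2π/3` (any masses and twists).

Part II (`CentreStabilisedCircleCFCCentreStabilityCentreSymmetry.lean`) supplies the flavour
shift (a relabelling of the quark variables) and integrates: the selection rule `Z(O) = 0` for
CFC-charged scalar functionals and `⟨tr P_x⃗⟩ = 0`.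

Pure theorem file, no definitions and no notation: the centre element enters each lemma as a
special unitary `z` with `↑z = ζ • 1` (hypothesis `hz`), the seam multiplier as a link function
`c` with `c l = if (l is a last-slice temporal link) then z else 1` (hypothesis `hc`).
-/

noncomputable section

namespace Summit.QuantumFields.QCD.Theorems.CentreStabilisedCircleCFC

open Literature.MathematicalPhysics.QuantumLattice Literature.MathematicalPhysics.QuantumFieldTheory

/-! ### The centre element `ω = e^{2πi/3}·1` of `SU(3)` -/

/-- The cube root of unity `ζ = e^{2πi/3}` is unimodular. -/
theorem norm_zeta : ‖Complex.exp (((2 * Real.pi / 3 : ℝ) : ℂ) * Complex.I)‖ = 1 :=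
  Complex.norm_exp_ofReal_mul_I _

/-- `ζ = e^{2πi/3} ≠ 0`. -/
theorem zeta_ne_zero : Complex.exp (((2 * Real.pi / 3 : ℝ) : ℂ) * Complex.I) ≠ 0 :=
  Complex.exp_ne_zero _

/-- `ζ³ = 1`. -/
theorem zeta_pow_three : Complex.exp (((2 * Real.pi / 3 : ℝ) : ℂ) * Complex.I) ^ 3 = 1 := by
  rw [← Complex.exp_nat_mul]
  have : ((3 : ℕ) : ℂ) * ((((2 * Real.pi / 3 : ℝ) : ℂ)) * Complex.I) = 2 * Real.pi * Complex.I := by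
    push_cast; ring
  rw [this, Complex.exp_two_pi_mul_I]

/-- `ζ = e^{2πi/3} ≠ 1` (a primitive cube root of unity). -/
theorem zeta_ne_one : Complex.exp (((2 * Real.pi / 3 : ℝ) : ℂ) * Complex.I) ≠ 1 := by
  intro h
  obtain ⟨n, hn⟩ := Complex.exp_eq_one_iff.1 h
  have hI : (((2 * Real.pi / 3 : ℝ) : ℂ) - (n : ℂ) * (2 * Real.pi)) * Complex.I = 0 := by
    rw [sub_mul, mul_assoc, ← hn, sub_self]
  have hre : (2 * Real.pi / 3 : ℝ) - (n : ℝ) * (2 * Real.pi) = 0 := by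
    rcases mul_eq_zero.1 hI with h0 | hI0
    · have := congrArg Complex.re h0
      simpa using this
    · exact absurd hI0 Complex.I_ne_zero
  have h' : 2 * Real.pi * (1 - 3 * (n : ℝ)) = 3 * ((2 * Real.pi / 3 : ℝ) - (n : ℝ) * (2 * Real.pi)) := by
    ring
  rw [hre, mul_zero] at h'
  rcases mul_eq_zero.1 h' with h0 | h0
  · exact absurd h0 (by positivity)
  · have h3 : (1 : ℝ) = 3 * (n : ℝ) := by linarith
    have h3' : (1 : ℤ) = 3 * n := by exact_mod_cast h3
    omega

/-- `ζ • 1` is a special unitary matrix. -/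
theorem zeta_smul_one_mem :
    Complex.exp (((2 * Real.pi / 3 : ℝ) : ℂ) * Complex.I) • (1 : Matrix (Fin 3) (Fin 3) ℂ) ∈ Matrix.specialUnitaryGroup (Fin 3) ℂ := by
  rw [Matrix.mem_specialUnitaryGroup_iff, Matrix.mem_unitaryGroup_iff]
  refine ⟨?_, ?_⟩
  · rw [star_smul, star_one, Matrix.smul_mul, Matrix.one_mul, smul_smul, Complex.star_def,
      Complex.mul_conj', norm_zeta]
    simp
  · rw [Matrix.det_smul, Matrix.det_one, mul_one, Fintype.card_fin, zeta_pow_three]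

section Centre

-- Throughout, `z` is a special unitary matrix whose underlying matrix is the scalar `ζ • 1`
-- (hypothesis `hz`; the element `⟨ζ • 1, zeta_smul_one_mem⟩` is the only one), i.e. the
-- centre element `ω = e^{2πi/3}·1` of `SU(3)`.
variable {z : Matrix.specialUnitaryGroup (Fin 3) ℂ}

/-- `ω` is central in `SU(3)`. -/
theorem centre_mul_comm
    (hz : (z : Matrix (Fin 3) (Fin 3) ℂ) =
      Complex.exp (((2 * Real.pi / 3 : ℝ) : ℂ) * Complex.I) • (1 : Matrix (Fin 3) (Fin 3) ℂ))
    (g : Matrix.specialUnitaryGroup (Fin 3) ℂ) : z * g = g * z := by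
  apply Subtype.ext
  change (z : Matrix (Fin 3) (Fin 3) ℂ) * (g : Matrix (Fin 3) (Fin 3) ℂ) =
    (g : Matrix (Fin 3) (Fin 3) ℂ) * (z : Matrix (Fin 3) (Fin 3) ℂ)
  rw [hz, Matrix.smul_mul, Matrix.mul_smul, Matrix.one_mul, Matrix.mul_one]

/-- The fundamental representation of `ω` is the scalar matrix `ζ • 1`. -/
theorem fundamentalRep_centre
    (hz : (z : Matrix (Fin 3) (Fin 3) ℂ) =
      Complex.exp (((2 * Real.pi / 3 : ℝ) : ℂ) * Complex.I) • (1 : Matrix (Fin 3) (Fin 3) ℂ)) :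
    fundamentalRep (Fin 3) z =
      Complex.exp (((2 * Real.pi / 3 : ℝ) : ℂ) * Complex.I) • (1 : Matrix (Fin 3) (Fin 3) ℂ) := hz

/-- `ρ(ω g) = ζ • ρ(g)`. -/
theorem fundamentalRep_centre_mul
    (hz : (z : Matrix (Fin 3) (Fin 3) ℂ) =
      Complex.exp (((2 * Real.pi / 3 : ℝ) : ℂ) * Complex.I) • (1 : Matrix (Fin 3) (Fin 3) ℂ))
    (g : Matrix.specialUnitaryGroup (Fin 3) ℂ) :
    fundamentalRep (Fin 3) (z * g) =
      Complex.exp (((2 * Real.pi / 3 : ℝ) : ℂ) * Complex.I) • fundamentalRep (Fin 3) g := by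
  rw [map_mul, fundamentalRep_centre hz, Matrix.smul_mul, Matrix.one_mul]

/-- `ρ((ω g)⁻¹) = ζ⁻¹ • ρ(g⁻¹)`. -/
theorem fundamentalRep_centre_mul_inv
    (hz : (z : Matrix (Fin 3) (Fin 3) ℂ) =
      Complex.exp (((2 * Real.pi / 3 : ℝ) : ℂ) * Complex.I) • (1 : Matrix (Fin 3) (Fin 3) ℂ))
    (g : Matrix.specialUnitaryGroup (Fin 3) ℂ) :
    fundamentalRep (Fin 3) (z * g)⁻¹ =
      (Complex.exp (((2 * Real.pi / 3 : ℝ) : ℂ) * Complex.I))⁻¹ • fundamentalRep (Fin 3) g⁻¹ := by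
  have h1 : fundamentalRep (Fin 3) (z * g)⁻¹ * fundamentalRep (Fin 3) (z * g) = 1 := by
    rw [← map_mul, inv_mul_cancel, map_one]
  rw [fundamentalRep_centre_mul hz, Matrix.mul_smul] at h1
  -- `ζ • (ρ((ωg)⁻¹) ρ(g)) = 1`, so `ρ((ωg)⁻¹) ρ(g) = ζ⁻¹ • 1`; then multiply by `ρ(g⁻¹)`.
  have h3 : fundamentalRep (Fin 3) (z * g)⁻¹ * fundamentalRep (Fin 3) g =
      (Complex.exp (((2 * Real.pi / 3 : ℝ) : ℂ) * Complex.I))⁻¹ • (1 : Matrix (Fin 3) (Fin 3) ℂ) := by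
    have := congrArg (fun M => (Complex.exp (((2 * Real.pi / 3 : ℝ) : ℂ) * Complex.I))⁻¹ • M) h1
    simpa [smul_smul, inv_mul_cancel₀ zeta_ne_zero] using this
  calc fundamentalRep (Fin 3) (z * g)⁻¹
      = fundamentalRep (Fin 3) (z * g)⁻¹ * fundamentalRep (Fin 3) g * fundamentalRep (Fin 3) g⁻¹ := by
        rw [mul_assoc, ← map_mul, mul_inv_cancel, map_one, mul_one]
    _ = (Complex.exp (((2 * Real.pi / 3 : ℝ) : ℂ) * Complex.I))⁻¹ • fundamentalRep (Fin 3) g⁻¹ := by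
        rw [h3, Matrix.smul_mul, Matrix.one_mul]

end Centre

/-! ### The seam twist `U ↦ c·U`: `c = ω` on the temporal links leaving the last slice -/

variable {Nt Ns : ℕ}

section Seam

-- Throughout, `z` is the centre element `ω` (hypothesis `hz`, see above) and `c` is the seam
-- multiplier: `z` on the links `((N_t − 1, x⃗), none)` leaving the last slice in the circle
-- direction, `1` on every other link (hypothesis `hc` of each lemma).
variable {z : Matrix.specialUnitaryGroup (Fin 3) ℂ} {c : QCDCircleConfig Nt Ns}

/-- A central element cancels across a plaquette: `ω a b (ω c)⁻¹ d⁻¹ = a b c⁻¹ d⁻¹`. -/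
theorem central_plaquette_cancel
    (hz : (z : Matrix (Fin 3) (Fin 3) ℂ) =
      Complex.exp (((2 * Real.pi / 3 : ℝ) : ℂ) * Complex.I) • (1 : Matrix (Fin 3) (Fin 3) ℂ))
    (a b g d : Matrix.specialUnitaryGroup (Fin 3) ℂ) :
    z * a * b * (z * g)⁻¹ * d⁻¹ = a * b * g⁻¹ * d⁻¹ := by
  have h : z * a * b * (z * g)⁻¹ * d⁻¹ = (z * (a * b * g⁻¹)) * z⁻¹ * d⁻¹ := by group
  rw [h, centre_mul_comm hz (a * b * g⁻¹), mul_inv_cancel_right]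

/-- Temporal plaquettes are invariant under the seam twist (`ω` enters once with each sign, and
is central). -/
theorem plaquette_seam_none_some
    (hz : (z : Matrix (Fin 3) (Fin 3) ℂ) =
      Complex.exp (((2 * Real.pi / 3 : ℝ) : ℂ) * Complex.I) • (1 : Matrix (Fin 3) (Fin 3) ℂ))
    (hc : ∀ l, c l = if l.2 = none ∧ l.1.1 = -1 then z else 1) (U : QCDCircleConfig Nt Ns)
    (x : SlabGauge.Site 3 Nt Ns) (i : Fin 3) :
    SlabGauge.plaquette (c * U) x none (some i) = SlabGauge.plaquette U x none (some i) := by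
  have h1 : c (x, none) = if x.1 = -1 then z else 1 := by rw [hc]; simp
  have h2 : c (x.shift none, some i) = 1 := by rw [hc]; simp
  have h3 : c (x.shift (some i), none) = if x.1 = -1 then z else 1 := by
    rw [hc]; simp [SlabGauge.Site.shift]
  have h4 : c (x, some i) = 1 := by rw [hc]; simp
  simp only [SlabGauge.plaquette, Pi.mul_apply, h1, h2, h3, h4, one_mul]
  by_cases hx : x.1 = -1
  · simp only [hx, if_true]
    exact central_plaquette_cancel hz _ _ _ _
  · simp only [hx, if_false, one_mul]

/-- Spatial plaquettes are untouched by the seam twist. -/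
theorem plaquette_seam_some_some
    (hc : ∀ l, c l = if l.2 = none ∧ l.1.1 = -1 then z else 1) (U : QCDCircleConfig Nt Ns)
    (x : SlabGauge.Site 3 Nt Ns) (i j : Fin 3) :
    SlabGauge.plaquette (c * U) x (some i) (some j) = SlabGauge.plaquette U x (some i) (some j) := by
  have h : ∀ (y : SlabGauge.Site 3 Nt Ns) (k : Fin 3), c (y, some k) = 1 := fun y k => by
    rw [hc]; simp
  simp only [SlabGauge.plaquette, Pi.mul_apply, h, one_mul]

/-- **The Wilson weight is invariant under the seam twist.** -/
theorem weight_seam_mul [NeZero Nt] [NeZero Ns]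
    (hz : (z : Matrix (Fin 3) (Fin 3) ℂ) =
      Complex.exp (((2 * Real.pi / 3 : ℝ) : ℂ) * Complex.I) • (1 : Matrix (Fin 3) (Fin 3) ℂ))
    (hc : ∀ l, c l = if l.2 = none ∧ l.1.1 = -1 then z else 1) (β : ℝ) (U : QCDCircleConfig Nt Ns) :
    SlabGauge.weight (fundamentalRep (Fin 3)) β β (c * U) =
      SlabGauge.weight (fundamentalRep (Fin 3)) β β U := by
  simp only [SlabGauge.weight, SlabGauge.minusAction, plaquette_seam_none_some hz hc,
    plaquette_seam_some_some hc]

/-- In `ZMod N_t`, a natural number `0 < j < N_t` is not `0`. -/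
theorem natCast_ne_zero_of_lt {j : ℕ} (hj0 : 0 < j) (hj : j < Nt) : ((j : ℕ) : ZMod Nt) ≠ 0 := by
  intro h
  rw [ZMod.natCast_eq_zero_iff] at h
  exact absurd (Nat.le_of_dvd hj0 h) (not_le.2 hj)

/-- **Holonomies under the seam twist**: a holonomy of `n ≤ N_t` forward steps from `(t, x⃗)`
picks up the factor `ω` exactly when it crosses the seam, i.e. when `t + j = −1` for some
`j < n`; otherwise it is unchanged. -/
theorem timeHolonomy_seam_mul [NeZero Nt]
    (hz : (z : Matrix (Fin 3) (Fin 3) ℂ) =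
      Complex.exp (((2 * Real.pi / 3 : ℝ) : ℂ) * Complex.I) • (1 : Matrix (Fin 3) (Fin 3) ℂ))
    (hc : ∀ l, c l = if l.2 = none ∧ l.1.1 = -1 then z else 1) (U : QCDCircleConfig Nt Ns)
    (x : Fin 3 → ZMod Ns) :
    ∀ n : ℕ, n ≤ Nt → ∀ t : ZMod Nt,
      ((∃ j : ℕ, j < n ∧ t + (j : ZMod Nt) = -1) →
        SlabGauge.timeHolonomy (c * U) n (t, x) = z * SlabGauge.timeHolonomy U n (t, x)) ∧
      ((¬ ∃ j : ℕ, j < n ∧ t + (j : ZMod Nt) = -1) →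
        SlabGauge.timeHolonomy (c * U) n (t, x) = SlabGauge.timeHolonomy U n (t, x)) := by
  intro n
  induction n with
  | zero =>
      intro _ t
      exact ⟨fun ⟨j, hj, _⟩ => absurd hj (Nat.not_lt_zero j), fun _ => rfl⟩
  | succ n ih =>
      intro hn t
      have hshift : SlabGauge.Site.shift ((t, x) : SlabGauge.Site 3 Nt Ns) none = (t + 1, x) := rfl
      have hstep : ∀ V : QCDCircleConfig Nt Ns, SlabGauge.timeHolonomy V (n + 1) (t, x) =
          V ((t, x), none) * SlabGauge.timeHolonomy V n (t + 1, x) := fun V => by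
        rw [SlabGauge.timeHolonomy, hshift]
      obtain ⟨ihA, ihB⟩ := ih (Nat.le_of_succ_le hn) (t + 1)
      have hct : c ((t, x), none) = if t = -1 then z else 1 := by rw [hc]; simp
      by_cases ht : t = -1
      · -- the first link is the seam link; the remaining `n < N_t` steps start at `0` and do
        -- not reach the seam again
        have hno : ¬ ∃ j : ℕ, j < n ∧ t + 1 + (j : ZMod Nt) = -1 := by
          rintro ⟨j, hj, hj'⟩
          rw [ht, neg_add_cancel, zero_add] at hj'
          have h0 : (((j + 1 : ℕ)) : ZMod Nt) = 0 := by
            push_cast; rw [hj', neg_add_cancel]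
          exact natCast_ne_zero_of_lt (Nat.succ_pos j) (by omega) h0
        have hlink : (c * U) ((t, x), none) = z * U ((t, x), none) := by
          rw [Pi.mul_apply, hct, if_pos ht]
        refine ⟨fun _ => ?_, fun h => absurd ⟨0, Nat.succ_pos n, by simp [ht]⟩ h⟩
        rw [hstep, hstep, hlink, ihB hno, mul_assoc]
      · have hlink : (c * U) ((t, x), none) = U ((t, x), none) := by
          rw [Pi.mul_apply, hct, if_neg ht, one_mul]
        have hiff : (∃ j : ℕ, j < n + 1 ∧ t + (j : ZMod Nt) = -1) ↔
            ∃ j : ℕ, j < n ∧ t + 1 + (j : ZMod Nt) = -1 := by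
          constructor
          · rintro ⟨j, hj, hj'⟩
            obtain _ | j := j
            · simp only [Nat.cast_zero, add_zero] at hj'
              exact absurd hj' ht
            · refine ⟨j, Nat.lt_of_succ_lt_succ hj, ?_⟩
              rw [← hj']; push_cast; ring
          · rintro ⟨j, hj, hj'⟩
            refine ⟨j + 1, Nat.succ_lt_succ hj, ?_⟩
            rw [← hj']; push_cast; ring
        refine ⟨fun h => ?_, fun h => ?_⟩
        · rw [hstep, hstep, hlink, ihA (hiff.1 h), ← mul_assoc, ← centre_mul_comm hz, mul_assoc]
        · rw [hstep, hstep, hlink, ihB (fun h' => h (hiff.2 h'))]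

/-- **The Polyakov loop acquires the centre factor**: `P_x⃗(c·U) = ω P_x⃗(U)`. -/
theorem polyakovLine_seam_mul [NeZero Nt]
    (hz : (z : Matrix (Fin 3) (Fin 3) ℂ) =
      Complex.exp (((2 * Real.pi / 3 : ℝ) : ℂ) * Complex.I) • (1 : Matrix (Fin 3) (Fin 3) ℂ))
    (hc : ∀ l, c l = if l.2 = none ∧ l.1.1 = -1 then z else 1) (U : QCDCircleConfig Nt Ns)
    (x : Fin 3 → ZMod Ns) :
    SlabGauge.polyakovLine (c * U) x = z * SlabGauge.polyakovLine U x := by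
  have hNt : 0 < Nt := Nat.pos_of_ne_zero (NeZero.ne Nt)
  refine (timeHolonomy_seam_mul hz hc U x Nt le_rfl 0).1 ⟨Nt - 1, Nat.sub_lt hNt one_pos, ?_⟩
  rw [zero_add]
  apply eq_neg_of_add_eq_zero_left
  have : (((Nt - 1 : ℕ)) : ZMod Nt) + 1 = (((Nt - 1 + 1 : ℕ)) : ZMod Nt) := by push_cast; ring
  rw [this, Nat.sub_add_cancel hNt, ZMod.natCast_self]

/-- The traced Polyakov loop is multiplied by `ζ = e^{2πi/3}`. -/
theorem polyakovTrace_seam_mul [NeZero Nt]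
    (hz : (z : Matrix (Fin 3) (Fin 3) ℂ) =
      Complex.exp (((2 * Real.pi / 3 : ℝ) : ℂ) * Complex.I) • (1 : Matrix (Fin 3) (Fin 3) ℂ))
    (hc : ∀ l, c l = if l.2 = none ∧ l.1.1 = -1 then z else 1) (U : QCDCircleConfig Nt Ns)
    (x : Fin 3 → ZMod Ns) :
    SlabGauge.polyakovTrace (fundamentalRep (Fin 3)) (c * U) x =
      Complex.exp (((2 * Real.pi / 3 : ℝ) : ℂ) * Complex.I) *
        SlabGauge.polyakovTrace (fundamentalRep (Fin 3)) U x := by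
  rw [SlabGauge.polyakovTrace, SlabGauge.polyakovTrace, polyakovLine_seam_mul hz hc,
    fundamentalRep_centre_mul hz, Matrix.trace_smul, smul_eq_mul]

/-- **The double-trace deformation weight is invariant under the seam twist** (`|ζ| = 1`). -/
theorem polyakovDeformationWeight_seam_mul [NeZero Nt] [NeZero Ns]
    (hz : (z : Matrix (Fin 3) (Fin 3) ℂ) =
      Complex.exp (((2 * Real.pi / 3 : ℝ) : ℂ) * Complex.I) • (1 : Matrix (Fin 3) (Fin 3) ℂ))
    (hc : ∀ l, c l = if l.2 = none ∧ l.1.1 = -1 then z else 1) (h : ℝ)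
    (U : QCDCircleConfig Nt Ns) :
    polyakovDeformationWeight h (c * U) = polyakovDeformationWeight h U := by
  simp only [polyakovDeformationWeight, polyakovTrace_seam_mul hz hc, norm_mul, norm_zeta, one_mul]

end Seam

/-! ### The twisted Wilson–Dirac matrix under the seam twist and the flavour shift -/

/-- The twist phases are multiplicative in the angle. -/
theorem flavourTwistPhase_add (a b : ℝ) (μ : SlabGauge.Dir 3) (s : SlabGauge.Site 3 Nt Ns) :
    flavourTwistPhase (a + b) μ s = flavourTwistPhase a μ s * flavourTwistPhase b μ s := by
  unfold flavourTwistPhase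
  split_ifs
  · rw [← Complex.exp_add]; push_cast; ring_nf
  · rw [one_mul]

/-- The twist phases are invertible. -/
theorem flavourTwistPhase_ne_zero (a : ℝ) (μ : SlabGauge.Dir 3) (s : SlabGauge.Site 3 Nt Ns) :
    flavourTwistPhase a μ s ≠ 0 := by
  unfold flavourTwistPhase
  split_ifs
  · exact Complex.exp_ne_zero _
  · exact one_ne_zero

section Seam

variable {z : Matrix.specialUnitaryGroup (Fin 3) ℂ} {c : QCDCircleConfig Nt Ns}

/-- Under the seam twist the represented link is multiplied by the seam phase
`flavourTwistPhase (2π/3)`. -/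
theorem fundamentalRep_seam_mul
    (hz : (z : Matrix (Fin 3) (Fin 3) ℂ) =
      Complex.exp (((2 * Real.pi / 3 : ℝ) : ℂ) * Complex.I) • (1 : Matrix (Fin 3) (Fin 3) ℂ))
    (hc : ∀ l, c l = if l.2 = none ∧ l.1.1 = -1 then z else 1) (U : QCDCircleConfig Nt Ns)
    (s : SlabGauge.Site 3 Nt Ns) (μ : SlabGauge.Dir 3) :
    fundamentalRep (Fin 3) ((c * U) (s, μ)) =
      flavourTwistPhase (2 * Real.pi / 3) μ s • fundamentalRep (Fin 3) (U (s, μ)) := by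
  rw [Pi.mul_apply, hc]
  unfold flavourTwistPhase
  by_cases h : μ = none ∧ s.1 = -1
  · simp only [h, and_self, if_true]
    exact fundamentalRep_centre_mul hz _
  · simp only [h, if_false, one_mul, one_smul]

/-- Under the seam twist the inverse represented link is divided by the seam phase. -/
theorem fundamentalRep_seam_mul_inv
    (hz : (z : Matrix (Fin 3) (Fin 3) ℂ) =
      Complex.exp (((2 * Real.pi / 3 : ℝ) : ℂ) * Complex.I) • (1 : Matrix (Fin 3) (Fin 3) ℂ))
    (hc : ∀ l, c l = if l.2 = none ∧ l.1.1 = -1 then z else 1) (U : QCDCircleConfig Nt Ns)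
    (s : SlabGauge.Site 3 Nt Ns) (μ : SlabGauge.Dir 3) :
    fundamentalRep (Fin 3) ((c * U) (s, μ))⁻¹ =
      (flavourTwistPhase (2 * Real.pi / 3) μ s)⁻¹ • fundamentalRep (Fin 3) (U (s, μ))⁻¹ := by
  rw [Pi.mul_apply, hc]
  unfold flavourTwistPhase
  by_cases h : μ = none ∧ s.1 = -1
  · simp only [h, and_self, if_true]
    exact fundamentalRep_centre_mul_inv hz _
  · simp only [h, if_false, one_mul, inv_one, one_smul]

/-- **The seam twist shifts every boundary twist by `2π/3`**:
`D(c·U; m, θ) = D(U; m, θ + 2π/3)` (any masses, any twists). -/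
theorem qcdCircleDirac_seam_mul {Nf : ℕ} [NeZero Nt] [NeZero Ns]
    (hz : (z : Matrix (Fin 3) (Fin 3) ℂ) =
      Complex.exp (((2 * Real.pi / 3 : ℝ) : ℂ) * Complex.I) • (1 : Matrix (Fin 3) (Fin 3) ℂ))
    (hc : ∀ l, c l = if l.2 = none ∧ l.1.1 = -1 then z else 1) (U : QCDCircleConfig Nt Ns)
    (mq θ : Fin Nf → ℝ) :
    qcdCircleDirac (c * U) mq θ = qcdCircleDirac U mq (fun f => θ f + 2 * Real.pi / 3) := by
  unfold qcdCircleDirac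
  congr 1
  ext v w
  simp only [Matrix.of_apply, fundamentalRep_seam_mul hz hc, fundamentalRep_seam_mul_inv hz hc,
    Matrix.smul_apply, smul_eq_mul, flavourTwistPhase_add]
  by_cases hvw : v.1 = w.1
  · simp only [hvw, if_true]
    congr 1
    congr 1
    refine Finset.sum_congr rfl fun μ _ => ?_
    congr 1
    · split_ifs
      · ring
      · rfl
    · split_ifs
      · rw [mul_inv]; ring
      · rfl
  · simp only [hvw, if_false]

end Seam

end Summit.QuantumFields.QCD.Theorems.CentreStabilisedCircleCFC

end
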